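import Literature.AlgebraicGeometry.Motives.OsculatingLineMultiplicity
import HarnessLib

/-!
# Lines of high contact with a hypersurface: the intersection cycles `e [x]` and `(e-1) [x] + [y]`

Roitman's technique for `0`-cycles on a hypersurface `X = V₊(F) ⊆ ℙᴺ` of degree `e ≤ N`
(A. A. Roitman, Mat. Zametki 28 (1980) 85–90; Hirschowitz–Iyer, Contemp. Math. 522 (2010) =
arXiv:0903.5018, §1.3: "The case of `0`-cycles has been handled by Roitman [Ro]. His method consists
in starting from a (positive) `0`-cycle `Z` on `Y`, and building a ruled cycle in `ℙⁿ` whose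
intersection with `Y` will be not too far from a multiple of `Z`. This is achieved by choosing a
ruling by lines which are strong …, in the sense that either they cut `Y` in a single (multiple)
point or they are inside `Y`", and §6, proof of Prop. 6.2 (i): the strong lines through `p` are cut
out, in the projectivised tangent space, by the homogeneous components of the Taylor expansion of the
equation at `p`) compares, through a point `x ∈ X`, a STRONG line `ℓ₀` (`F(s x + t y) = tᵉ F(y)`:
it meets `X` only at `x`, `V₊(F) · [ℓ₀] = e [x]`, or lies on `X`) with a line `ℓ₁` of contact
order `e - 1` at `x` whose residual intersection point `y` lies on `X` (`F(s x + t y) = a s tᵉ⁻¹`,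
`V₊(F) · [ℓ₁] = (e-1) [x] + [y]`); since `[ℓ₀] = [ℓ₁]` in `CH₁(ℙᴺ)`, intersecting with `V₊(F)`
(Fulton, *Intersection Theory*, Cor. 2.4.1) gives `[x] = [y]` in `CH₀(X)`. (The same lines appear
in Mboro, arXiv:1701.04488, Lemma 1.1: "the line `l` is osculating iff `f_j(Y) = 0` for all
`j < d`".)

This file proves the polynomial identities and the two intersection CYCLES on `ℙᴺ_K` (any field
`K`, `K` infinite for the cycles), generalising `Motives/OsculatingLineMultiplicity` (the cubic
case `V₊(F) · [ℓ] = 3 [x]`) to every degree and to the contact-`(e-1)` line: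

* `ProjSpace.eval_add_smul_eq_sum_coeff_linePoly` — the expansion
  `F(s x + t y) = Σ_j sʲ tᵉ⁻ʲ c_j(y)` along the coefficient forms `c_j = coeff_{sʲ} F(s x + y)`
  (`Literature.RingTheory.MvPolynomial.linePoly`, degrees `e - j`);
* `ProjSpace.eval_coeff_single_degree_linePoly` — `c_e ≡ 0` when `F(x) = 0`;
* `ProjSpace.eval_add_smul_eq_pow_mul_of_forall_coeff` — **`F(s x + t y) = tᵉ F(y)`** when
  `F(x) = 0` and `c_j(y) = 0` for `1 ≤ j < e` (full contact);
* `ProjSpace.eval_add_smul_eq_mul_of_forall_coeff` — **`F(s x + t y) = s tᵉ⁻¹ c₁(y)`** when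
  `F(x) = F(y) = 0` and `c_j(y) = 0` for `2 ≤ j < e` (contact `e - 1`, residual point `y ∈ X`);
* `ProjSpace.primeInter_formDivisor_line_eq_degree_smul` — **`V₊(F) · [V₊(μ)] = e · [[x]]`** for
  the line `V₊(μ)` through `[x], [y]` when `F(s x + t y) = tᵉ F(y)`, `F(y) ≠ 0`;
* `ProjSpace.primeInter_formDivisor_line_eq_pred_smul_add` — **`V₊(F) · [V₊(μ)] =
  (e-1) · [[x]] + [[y]]`** when `F(s x + t y) = a s tᵉ⁻¹`, `a ≠ 0`
  (`F ≡ c · λ' · λᵉ⁻¹ mod 𝔭_{V₊(μ)}` with `λ(x) = 0 ≠ λ(y)`, `λ'(y) = 0 ≠ λ'(x)`; Fulton Prop. 2.3 (b)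
  and Example 2.5.1 through `primeInter_formDivisor_prod_linear`,
  `primeInter_formDivisor_linear_line_eq_primeCycle`).

Everything is proved; no named facts, no definitions.

## References

* [HirschowitzIyer2010] A. Hirschowitz, J. N. N. Iyer, Hilbert schemes of fat r-planes and the
  triviality of Chow groups of complete intersections, Contemp. Math. 522 (2010) 53–70 =
  arXiv:0903.5018, §1.3 and §6, proof of Prop. 6.2 (i) (text read).
* [Roitman1980] A. A. Roitman, Rational equivalence of zero-dimensional cycles, Mat. Zametki 28
  (1980) 85–90 = Math. Notes 28 (1980) (cite-only; [Ro] of Hirschowitz–Iyer).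
* [Mboro2018] R. Mboro, Remarks on the CH₂ of cubic hypersurfaces, arXiv:1701.04488, Lemma 1.1.
* [Fulton1998] W. Fulton, Intersection Theory, 2nd ed. (1998), Def. 2.3, Prop. 2.3 (b),
  Example 2.5.1.
-/

noncomputable section

open CategoryTheory AlgebraicGeometry Order MvPolynomial
open Literature.AlgebraicGeometry.Motives.Segre

universe u

namespace Literature.AlgebraicGeometry.Motives

-- No `attribute [local instance] MvPolynomial.gradedAlgebra`: the two proofs needing the grading of
-- `K[x₀, …, x_N]` supply it by an inline `letI` (pattern of `Motives/ChowZeroSupportedOnHyperplaneSection`).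

namespace ProjSpace

open ProjFamily ProjectiveSpace ProjectiveSpaceCells Literature.RingTheory.MvPolynomial

variable {K : Type u} [Field K] {N : ℕ}

/-! ### The expansion of `F(s x + t y)` along the coefficient forms of `F(s x + y)` -/

/-- **`F(s x + t y) = Σ_j sʲ tᵉ⁻ʲ c_j(y)`** for a form `F` of degree `e`, where
`c_j = coeff_{sʲ} F(s x + y) ∈ K[y]` is the coefficient form of degree `e - j` of
`linePoly x F = F(s x + y)` (the sum runs over the `s`-support of `F(s x + y)`). [folklore] -/
theorem eval_add_smul_eq_sum_coeff_linePoly {F : MvPolynomial (Fin (N + 1)) K} {e : ℕ}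
    (hF : F.IsHomogeneous e) (x y : Fin (N + 1) → K) (s t : K) :
    eval (s • x + t • y) F =
      ∑ α ∈ (linePoly x F).support,
        s ^ α.degree * t ^ (e - α.degree) * eval y (coeff α (linePoly x F)) := by
  classical
  rw [← eval_eval_linePoly x F s (t • y), eval_eval_eq_sum]
  refine Finset.sum_congr rfl fun α _ => ?_
  have h0 : α.degree = α 0 := by rw [Finsupp.degree_eq_sum, Fin.sum_univ_one]
  rw [eval_smul_of_isHomogeneous (isBihom_linePoly x hF α).1, Fin.prod_univ_one, ← mul_assoc, h0]

/-- **The top coefficient vanishes**: if `F(x) = 0` then the coefficient of `sᵉ` of `F(s x + y)`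
(a form of degree `0`, i.e. the constant `F(x)`) is zero at every `y`. [folklore] -/
theorem eval_coeff_single_degree_linePoly {F : MvPolynomial (Fin (N + 1)) K} {e : ℕ}
    (hF : F.IsHomogeneous e) {x : Fin (N + 1) → K} (hx : eval x F = 0) (y : Fin (N + 1) → K) :
    eval y (coeff (Finsupp.single 0 e) (linePoly x F)) = 0 := by
  classical
  by_cases hmem : Finsupp.single 0 e ∈ (linePoly x F).support
  swap
  · rw [notMem_support_iff.1 hmem, map_zero]
  have h := eval_add_smul_eq_sum_coeff_linePoly hF x y 1 0
  rw [one_smul, zero_smul, add_zero, hx, Finset.sum_eq_single_of_mem _ hmem] at h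
  · rw [Finsupp.degree_single, Nat.sub_self, pow_zero, one_pow, one_mul, one_mul] at h
    exact h.symm
  · intro α _ hne
    rcases lt_trichotomy α.degree e with hlt | heq | hgt
    · rw [zero_pow (Nat.sub_ne_zero_of_lt hlt), mul_zero, zero_mul]
    · exact absurd (by rw [finsupp_fin_one_eq_single α, heq]) hne
    · rw [(isBihom_linePoly x hF α).2 hgt, map_zero, mul_zero]

/-- **Full contact: `F(s x + t y) = tᵉ F(y)`** when `F(x) = 0` and the coefficient forms `c_j`,
`1 ≤ j < e`, of `F(s x + y)` vanish at `y` — the line `[x][y]` meets `V₊(F)` only at `[x]`, or lies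
on it (Roitman's STRONG lines: "either they cut `Y` in a single (multiple) point or they are inside `Y`";
Mboro, Lemma 1.1). [cite: HirschowitzIyer2010, §1.3 and proof of Prop. 6.2 (i)]
[cite: Mboro2018, Lemma 1.1 (arXiv:1701.04488, p. 6)] -/
theorem eval_add_smul_eq_pow_mul_of_forall_coeff {F : MvPolynomial (Fin (N + 1)) K} {e : ℕ}
    (hF : F.IsHomogeneous e) {x y : Fin (N + 1) → K} (hx : eval x F = 0)
    (hy : ∀ j, 1 ≤ j → j < e → eval y (coeff (Finsupp.single 0 j) (linePoly x F)) = 0)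
    (s t : K) : eval (s • x + t • y) F = t ^ e * eval y F := by
  classical
  rw [eval_add_smul_eq_sum_coeff_linePoly hF x y s t, Finset.sum_eq_single (0 : Fin 1 →₀ ℕ)]
  · rw [map_zero, pow_zero, one_mul, Nat.sub_zero, eval_coeff_zero_linePoly]
  · intro α _ hne
    obtain ⟨j, rfl⟩ : ∃ j, α = Finsupp.single 0 j := ⟨_, finsupp_fin_one_eq_single α⟩
    have hj0 : j ≠ 0 := by
      rintro rfl
      exact hne (by rw [Finsupp.single_zero])
    rw [Finsupp.degree_single]
    rcases Nat.lt_or_ge j e with hlt | hge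
    · rw [hy j (Nat.pos_of_ne_zero hj0) hlt, mul_zero]
    · rcases hge.eq_or_lt with heq | hgt
      · rw [← heq, eval_coeff_single_degree_linePoly hF hx, mul_zero]
      · rw [(isBihom_linePoly x hF _).2 (by rwa [Finsupp.degree_single]), map_zero, mul_zero]
  · intro h
    simp only [notMem_support_iff.1 h, map_zero, mul_zero]

/-- **Contact `e - 1` with residual point on the hypersurface: `F(s x + t y) = s tᵉ⁻¹ c₁(y)`** when
`F(x) = F(y) = 0` and the coefficient forms `c_j`, `2 ≤ j < e`, of `F(s x + y)` vanish at `y`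
(`c₁` the coefficient of `s`, a form of degree `e - 1`).
[cite: HirschowitzIyer2010, §1.3 and proof of Prop. 6.2 (i)] [cite: Roitman1980] -/
theorem eval_add_smul_eq_mul_of_forall_coeff {F : MvPolynomial (Fin (N + 1)) K} {e : ℕ}
    (hF : F.IsHomogeneous e) {x y : Fin (N + 1) → K} (hx : eval x F = 0) (hyF : eval y F = 0)
    (hy : ∀ j, 2 ≤ j → j < e → eval y (coeff (Finsupp.single 0 j) (linePoly x F)) = 0)
    (s t : K) :
    eval (s • x + t • y) F = s * t ^ (e - 1) * eval y (coeff (Finsupp.single 0 1) (linePoly x F)) := by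
  classical
  rw [eval_add_smul_eq_sum_coeff_linePoly hF x y s t,
    Finset.sum_eq_single (Finsupp.single (0 : Fin 1) 1)]
  · rw [Finsupp.degree_single, pow_one]
  · intro α _ hne
    obtain ⟨j, rfl⟩ : ∃ j, α = Finsupp.single 0 j := ⟨_, finsupp_fin_one_eq_single α⟩
    have hj1 : j ≠ 1 := by
      rintro rfl
      exact hne rfl
    rw [Finsupp.degree_single]
    rcases Nat.lt_or_ge j e with hlt | hge
    · rcases Nat.lt_or_ge j 2 with hj2 | hj2
      · obtain rfl : j = 0 := by omega
        rw [Finsupp.single_zero, eval_coeff_zero_linePoly, hyF, mul_zero]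
      · rw [hy j hj2 hlt, mul_zero]
    · rcases hge.eq_or_lt with heq | hgt
      · rw [← heq, eval_coeff_single_degree_linePoly hF hx, mul_zero]
      · rw [(isBihom_linePoly x hF _).2 (by rwa [Finsupp.degree_single]), map_zero, mul_zero]
  · intro h
    simp only [notMem_support_iff.1 h, map_zero, mul_zero]

/-! ### The intersection cycles of the two lines with `V₊(F)` -/

/-- `![y, x]` is independent when `![x, y]` is: this is Mathlib's
`LinearIndependent.pair_symm_iff` (forward direction); kept as a deprecated alias. [folklore] -/
@[deprecated LinearIndependent.pair_symm_iff (since := "2026-08-16")]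
theorem linearIndependent_pair_symm {x y : Fin (N + 1) → K} (hxy : LinearIndependent K ![x, y]) :
    LinearIndependent K ![y, x] :=
  LinearIndependent.pair_symm_iff.mp hxy

variable [Infinite K]

/-- **A line of full contact meets the hypersurface in its point of contact with multiplicity the
degree: `V₊(F) · [V₊(μ)] = e · [[x]]`.** For independent `x, y ∈ Kᴺ⁺¹`, a form `F` of degree
`e ≥ 1` with `F(s x + t y) = tᵉ F(y)` for all `s, t` and `F(y) ≠ 0` (the line `[x][y]` is not on
`V₊(F)`), and `μ` the `N - 1` equations of the line (vanishing at `x, y`, generating the ideal of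
forms vanishing on `span(x, y)`): `F ≡ c λᵉ mod (μ)` for a linear `λ` with `λ(x) = 0 ≠ λ(y)`,
`c = F(y)/λ(y)ᵉ`, so `V₊(F) · [V₊(μ)] = Σ_{t < e} V₊(λ) · [V₊(μ)] = e [[x]]` (Fulton, Prop. 2.3 (b)
and Example 2.5.1). The case `e = 3` is `primeInter_formDivisor_line_eq_three_smul`.
[cite: HirschowitzIyer2010, §1.3 ("cut `Y` in a single (multiple) point")] [cite: Fulton1998, Prop. 2.3 (b) and Example 2.5.1] -/
theorem primeInter_formDivisor_line_eq_degree_smul (hN : 1 ≤ N) {x y : Fin (N + 1) → K}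
    (hxy : LinearIndependent K ![x, y]) {e : ℕ} (he : 0 < e)
    {F : MvPolynomial (Fin (N + 1)) K} (hF : F ∈ grading (Fin (N + 1)) K e) (hF0 : F ≠ 0)
    (hosc : ∀ s t : K, eval (s • x + t • y) F = t ^ e * eval y F) (hFy : eval y F ≠ 0)
    {μ : Fin (N - 1) → MvPolynomial (Fin (N + 1)) K} (hμli : LinearIndependent K μ)
    (hμhom : ∀ l, (μ l).IsHomogeneous 1) (hμx : ∀ l, eval x (μ l) = 0) (hμy : ∀ l, eval y (μ l) = 0)
    (hμideal : ∀ G : MvPolynomial (Fin (N + 1)) K,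
      (∀ s t : K, eval (s • x + t • y) G = 0) → G ∈ Ideal.span (Set.range μ)) :
    (formDivisor F hF hF0).primeInter (X := projectiveSpace N K)
        (linearSubspacePoint μ hμli hμhom (Nat.sub_le N 1)) =
      e • primeCycle (pointOfVec K x (by simpa using hxy.ne_zero 0)).pt := by
  classical
  letI := MvPolynomial.gradedAlgebra (σ := Fin (N + 1)) (R := K)
  have hx0 : x ≠ 0 := by simpa using hxy.ne_zero 0
  obtain ⟨m, rfl⟩ : ∃ m, e = m + 1 := ⟨e - 1, by omega⟩
  obtain ⟨lam, hlamhom, hlamx, hlamy⟩ := exists_linearForm_eval_eq_zero_ne_zero hN hxy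
  have hlam : lam ∈ grading (Fin (N + 1)) K 1 := (mem_homogeneousSubmodule 1 lam).2 hlamhom
  have hlam0 : lam ≠ 0 := by rintro rfl; exact hlamy (map_zero _)
  set w := linearSubspacePoint μ hμli hμhom (Nat.sub_le N 1) with hw
  -- the constant `c = F(y)/λ(y)ᵉ` and the split form `(c λ) · λ ⋯ λ`
  set c : K := eval y F / eval y lam ^ (m + 1) with hc
  have hc0 : c ≠ 0 := div_ne_zero hFy (pow_ne_zero _ hlamy)
  have hclam : C c * lam ∈ grading (Fin (N + 1)) K 1 := by
    have h := Submodule.smul_mem (grading (Fin (N + 1)) K 1) c hlam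
    rwa [smul_eq_C_mul] at h
  have hclam0 : C c * lam ≠ 0 := mul_ne_zero (by rwa [Ne, C_eq_zero]) hlam0
  have hclamx : eval x (C c * lam) = 0 := by rw [map_mul, hlamx, mul_zero]
  have hclamy : eval y (C c * lam) ≠ 0 := by rw [map_mul, eval_C]; exact mul_ne_zero hc0 hlamy
  set ℓ : Fin (m + 1) → MvPolynomial (Fin (N + 1)) K := Fin.cons (C c * lam) (fun _ => lam) with hℓ
  have hℓ0 : ℓ 0 = C c * lam := by rw [hℓ]; exact Fin.cons_zero _ _
  have hℓs : ∀ j : Fin m, ℓ j.succ = lam := fun j => by rw [hℓ]; exact Fin.cons_succ _ _ j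
  have hℓg : ∀ t, ℓ t ∈ grading (Fin (N + 1)) K 1 := fun t => by
    refine Fin.cases ?_ (fun j => ?_) t
    · rw [hℓ0]; exact hclam
    · rw [hℓs]; exact hlam
  have hprod : (∏ t, ℓ t) = C c * lam * lam ^ m := by
    rw [Fin.prod_univ_succ, hℓ0]
    simp only [hℓs, Finset.prod_const, Finset.card_univ, Fintype.card_fin]
  have hG : (∏ t, ℓ t) ∈ grading (Fin (N + 1)) K (m + 1) := prod_mem_grading_of_linear ℓ hℓg
  have hG0 : (∏ t, ℓ t) ≠ 0 := by
    rw [hprod]; exact mul_ne_zero hclam0 (pow_ne_zero _ hlam0)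
  -- `F - (c λ) λ ⋯ λ` vanishes on `span(x, y)`, hence lies in `𝔭_w = (μ)`
  have hlamline : ∀ s t : K, eval (s • x + t • y) lam = t * eval y lam := by
    intro s t
    rw [eval_add_smul_of_isHomogeneous_one hlamhom, hlamx, mul_zero, zero_add]
  have hdiff : F - ∏ t, ℓ t ∈ ProjectiveSpectrum.asHomogeneousIdeal
      (𝒜 := MvPolynomial.homogeneousSubmodule (Fin (N + 1)) K) w := by
    change F - ∏ t, ℓ t ∈ (ProjectiveSpectrum.asHomogeneousIdeal
      (𝒜 := MvPolynomial.homogeneousSubmodule (Fin (N + 1)) K) w).toIdeal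
    rw [hw, toIdeal_linearSubspacePoint, hprod]
    refine hμideal _ fun s t => ?_
    simp only [map_sub, map_mul, map_pow, eval_C, hosc s t, hlamline s t]
    rw [hc]
    field_simp
    ring
  have hFw := notMem_asHomogeneousIdeal_linearSubspacePoint_of_eval_ne_zero hμli hμhom hμy hFy
  have hℓw : ∀ t, ℓ t ∉ ProjectiveSpectrum.asHomogeneousIdeal
      (𝒜 := MvPolynomial.homogeneousSubmodule (Fin (N + 1)) K) w := fun t => by
    refine Fin.cases ?_ (fun j => ?_) t
    · rw [hℓ0]
      exact notMem_asHomogeneousIdeal_linearSubspacePoint_of_eval_ne_zero hμli hμhom hμy hclamy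
    · rw [hℓs]
      exact notMem_asHomogeneousIdeal_linearSubspacePoint_of_eval_ne_zero hμli hμhom hμy hlamy
  -- each linear factor cuts the line in `[x]` with multiplicity one
  have hsummand : ∀ t, (formDivisor (ℓ t) (hℓg t)
      (fun h => hG0 (Finset.prod_eq_zero (Finset.mem_univ t) h))).primeInter
        (X := projectiveSpace N K) w = primeCycle (pointOfVec K x hx0).pt := fun t => by
    refine Fin.cases ?_ (fun j => ?_) t
    · rw [formDivisor_congr hℓ0 (hℓg 0) _ hclam hclam0 rfl]
      exact primeInter_formDivisor_linear_line_eq_primeCycle hN hx0 hμli hμhom hμx hμy hclam hclam0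
        hclamx hclamy
    · rw [formDivisor_congr (hℓs j) (hℓg j.succ) _ hlam hlam0 rfl]
      exact primeInter_formDivisor_linear_line_eq_primeCycle hN hx0 hμli hμhom hμx hμy hlam hlam0
        hlamx hlamy
  rw [primeInter_formDivisor_congr (Nat.succ_pos m) hF hF0 hG hG0 hFw hdiff,
    primeInter_formDivisor_prod_linear ℓ hℓg hG hG0 hℓw, Finset.sum_congr rfl fun t _ => hsummand t,
    Finset.sum_const, Finset.card_univ, Fintype.card_fin]

/-- **A line of contact `e - 1` whose residual point lies on the hypersurface:
`V₊(F) · [V₊(μ)] = (e-1) · [[x]] + [[y]]`.** For independent `x, y ∈ Kᴺ⁺¹`, a form `F` of degree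
`e ≥ 1` with `F(s x + t y) = a · s tᵉ⁻¹` for all `s, t` and `a ≠ 0` (contact order exactly `e - 1`
at `[x]`, the remaining intersection point being `[y]`), and `μ` the equations of the line `[x][y]`:
`F ≡ c λ' λᵉ⁻¹ mod (μ)` with `λ(x) = 0 ≠ λ(y)`, `λ'(y) = 0 ≠ λ'(x)`, `c = a/(λ'(x) λ(y)ᵉ⁻¹)`, so
`V₊(F) · [V₊(μ)] = V₊(cλ') · [V₊(μ)] + Σ_{t < e-1} V₊(λ) · [V₊(μ)] = [[y]] + (e-1) [[x]]`
(Fulton, Prop. 2.3 (b) and Example 2.5.1). [cite: Roitman1980] [cite: Fulton1998, Prop. 2.3 (b) and Example 2.5.1] -/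
theorem primeInter_formDivisor_line_eq_pred_smul_add (hN : 1 ≤ N) {x y : Fin (N + 1) → K}
    (hxy : LinearIndependent K ![x, y]) {e : ℕ} (he : 0 < e)
    {F : MvPolynomial (Fin (N + 1)) K} (hF : F ∈ grading (Fin (N + 1)) K e) (hF0 : F ≠ 0)
    {a : K} (ha : a ≠ 0) (hosc : ∀ s t : K, eval (s • x + t • y) F = s * t ^ (e - 1) * a)
    {μ : Fin (N - 1) → MvPolynomial (Fin (N + 1)) K} (hμli : LinearIndependent K μ)
    (hμhom : ∀ l, (μ l).IsHomogeneous 1) (hμx : ∀ l, eval x (μ l) = 0) (hμy : ∀ l, eval y (μ l) = 0)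
    (hμideal : ∀ G : MvPolynomial (Fin (N + 1)) K,
      (∀ s t : K, eval (s • x + t • y) G = 0) → G ∈ Ideal.span (Set.range μ)) :
    (formDivisor F hF hF0).primeInter (X := projectiveSpace N K)
        (linearSubspacePoint μ hμli hμhom (Nat.sub_le N 1)) =
      (e - 1) • primeCycle (pointOfVec K x (by simpa using hxy.ne_zero 0)).pt +
        primeCycle (pointOfVec K y (by simpa using hxy.ne_zero 1)).pt := by
  classical
  letI := MvPolynomial.gradedAlgebra (σ := Fin (N + 1)) (R := K)
  have hx0 : x ≠ 0 := by simpa using hxy.ne_zero 0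
  have hy0 : y ≠ 0 := by simpa using hxy.ne_zero 1
  have hyx : LinearIndependent K ![y, x] := LinearIndependent.pair_symm_iff.mp hxy
  obtain ⟨m, rfl⟩ : ∃ m, e = m + 1 := ⟨e - 1, by omega⟩
  simp only [Nat.add_sub_cancel] at hosc ⊢
  -- `λ(x) = 0 ≠ λ(y)` and `λ'(y) = 0 ≠ λ'(x)`
  obtain ⟨lam, hlamhom, hlamx, hlamy⟩ := exists_linearForm_eval_eq_zero_ne_zero hN hxy
  obtain ⟨lam', hlam'hom, hlam'y, hlam'x⟩ := exists_linearForm_eval_eq_zero_ne_zero hN hyx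
  have hlam : lam ∈ grading (Fin (N + 1)) K 1 := (mem_homogeneousSubmodule 1 lam).2 hlamhom
  have hlam0 : lam ≠ 0 := by rintro rfl; exact hlamy (map_zero _)
  have hlam' : lam' ∈ grading (Fin (N + 1)) K 1 := (mem_homogeneousSubmodule 1 lam').2 hlam'hom
  set w := linearSubspacePoint μ hμli hμhom (Nat.sub_le N 1) with hw
  -- the constant `c = a/(λ'(x) λ(y)ᵉ⁻¹)` and the split form `(c λ') · λ ⋯ λ`
  set c : K := a / (eval x lam' * eval y lam ^ m) with hc
  have hc0 : c ≠ 0 := div_ne_zero ha (mul_ne_zero hlam'x (pow_ne_zero _ hlamy))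
  have hclam : C c * lam' ∈ grading (Fin (N + 1)) K 1 := by
    have h := Submodule.smul_mem (grading (Fin (N + 1)) K 1) c hlam'
    rwa [smul_eq_C_mul] at h
  have hclam0 : C c * lam' ≠ 0 := by
    refine mul_ne_zero (by rwa [Ne, C_eq_zero]) ?_
    rintro rfl; exact hlam'x (map_zero _)
  have hclamy : eval y (C c * lam') = 0 := by rw [map_mul, hlam'y, mul_zero]
  have hclamx : eval x (C c * lam') ≠ 0 := by rw [map_mul, eval_C]; exact mul_ne_zero hc0 hlam'x
  set ℓ : Fin (m + 1) → MvPolynomial (Fin (N + 1)) K := Fin.cons (C c * lam') (fun _ => lam) with hℓ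
  have hℓ0 : ℓ 0 = C c * lam' := by rw [hℓ]; exact Fin.cons_zero _ _
  have hℓs : ∀ j : Fin m, ℓ j.succ = lam := fun j => by rw [hℓ]; exact Fin.cons_succ _ _ j
  have hℓg : ∀ t, ℓ t ∈ grading (Fin (N + 1)) K 1 := fun t => by
    refine Fin.cases ?_ (fun j => ?_) t
    · rw [hℓ0]; exact hclam
    · rw [hℓs]; exact hlam
  have hprod : (∏ t, ℓ t) = C c * lam' * lam ^ m := by
    rw [Fin.prod_univ_succ, hℓ0]
    simp only [hℓs, Finset.prod_const, Finset.card_univ, Fintype.card_fin]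
  have hG : (∏ t, ℓ t) ∈ grading (Fin (N + 1)) K (m + 1) := prod_mem_grading_of_linear ℓ hℓg
  have hG0 : (∏ t, ℓ t) ≠ 0 := by
    rw [hprod]; exact mul_ne_zero hclam0 (pow_ne_zero _ hlam0)
  -- `F - (c λ') λ ⋯ λ` vanishes on `span(x, y)`, hence lies in `𝔭_w = (μ)`
  have hlamline : ∀ s t : K, eval (s • x + t • y) lam = t * eval y lam := by
    intro s t
    rw [eval_add_smul_of_isHomogeneous_one hlamhom, hlamx, mul_zero, zero_add]
  have hlam'line : ∀ s t : K, eval (s • x + t • y) lam' = s * eval x lam' := by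
    intro s t
    rw [eval_add_smul_of_isHomogeneous_one hlam'hom, hlam'y, mul_zero, add_zero]
  have hFw : F ∉ ProjectiveSpectrum.asHomogeneousIdeal
      (𝒜 := MvPolynomial.homogeneousSubmodule (Fin (N + 1)) K) w := by
    have hF11 : eval ((1 : K) • x + (1 : K) • y) F ≠ 0 := by
      rw [hosc 1 1, one_pow, one_mul, one_mul]; exact ha
    intro h
    have h' : F ∈ (ProjectiveSpectrum.asHomogeneousIdeal
      (𝒜 := MvPolynomial.homogeneousSubmodule (Fin (N + 1)) K) w).toIdeal := h
    rw [hw, toIdeal_linearSubspacePoint] at h'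
    refine hF11 (eval_eq_zero_of_mem_idealSpan (fun l => ?_) h')
    simp only [eval_add_smul_of_isHomogeneous_one (hμhom l), hμx l, hμy l, mul_zero, add_zero]
  have hdiff : F - ∏ t, ℓ t ∈ ProjectiveSpectrum.asHomogeneousIdeal
      (𝒜 := MvPolynomial.homogeneousSubmodule (Fin (N + 1)) K) w := by
    change F - ∏ t, ℓ t ∈ (ProjectiveSpectrum.asHomogeneousIdeal
      (𝒜 := MvPolynomial.homogeneousSubmodule (Fin (N + 1)) K) w).toIdeal
    rw [hw, toIdeal_linearSubspacePoint, hprod]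
    refine hμideal _ fun s t => ?_
    simp only [map_sub, map_mul, map_pow, eval_C, hosc s t, hlamline s t, hlam'line s t]
    rw [hc]
    field_simp
    ring
  have hℓw : ∀ t, ℓ t ∉ ProjectiveSpectrum.asHomogeneousIdeal
      (𝒜 := MvPolynomial.homogeneousSubmodule (Fin (N + 1)) K) w := fun t => by
    refine Fin.cases ?_ (fun j => ?_) t
    · rw [hℓ0]
      exact notMem_asHomogeneousIdeal_linearSubspacePoint_of_eval_ne_zero hμli hμhom hμx hclamx
    · rw [hℓs]
      exact notMem_asHomogeneousIdeal_linearSubspacePoint_of_eval_ne_zero hμli hμhom hμy hlamy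
  -- `V₊(cλ') · [w] = [[y]]` and `V₊(λ) · [w] = [[x]]`
  have hsummand : ∀ j : Fin m, (formDivisor (ℓ j.succ) (hℓg j.succ)
      (fun h => hG0 (Finset.prod_eq_zero (Finset.mem_univ j.succ) h))).primeInter
        (X := projectiveSpace N K) w = primeCycle (pointOfVec K x hx0).pt := fun j => by
    rw [formDivisor_congr (hℓs j) (hℓg j.succ) _ hlam hlam0 rfl]
    exact primeInter_formDivisor_linear_line_eq_primeCycle hN hx0 hμli hμhom hμx hμy hlam hlam0
      hlamx hlamy
  have hsummand0 : (formDivisor (ℓ 0) (hℓg 0)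
      (fun h => hG0 (Finset.prod_eq_zero (Finset.mem_univ 0) h))).primeInter
        (X := projectiveSpace N K) w = primeCycle (pointOfVec K y hy0).pt := by
    rw [formDivisor_congr hℓ0 (hℓg 0) _ hclam hclam0 rfl]
    exact primeInter_formDivisor_linear_line_eq_primeCycle hN hy0 hμli hμhom hμy hμx hclam hclam0
      hclamy hclamx
  rw [primeInter_formDivisor_congr (Nat.succ_pos m) hF hF0 hG hG0 hFw hdiff,
    primeInter_formDivisor_prod_linear ℓ hℓg hG hG0 hℓw, Fin.sum_univ_succ, hsummand0,
    Finset.sum_congr rfl fun j _ => hsummand j, Finset.sum_const, Finset.card_univ,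
    Fintype.card_fin, add_comm]

end ProjSpace

end Literature.AlgebraicGeometry.Motives

end
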